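import Mathlib.Analysis.Calculus.ContDiff.Bounds
import Literature.Analysis.FluidPDE.SolenoidalTruncation
import HarnessLib

/-!
# Parametric integrals with smooth integrands over compact parameter sets: derivatives of all orders
  (tools for item stmt-NavierStokesRegularity-2928, `RobustBlowupPortability.DivFreeTruncation`)

Let `H` be a finite-dimensional real normed space (the differentiation variable), `P` a
finite-dimensional real normed space carrying a measure `μ` finite on compact sets (the parameter),
`S ⊆ P` compact and `f : H → P → F` with `(x, p) ↦ f x p` of class `C^∞`. Then
`g x = ∫ p in S, f x p ∂μ` is `C^∞`, and for every `n`

  `iteratedFDeriv ℝ n g x = ∫ p in S, iteratedFDeriv ℝ n (f · p) x ∂μ`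

(`iteratedFDeriv_setIntegral_of_contDiff`; induction on `n`, the step being differentiation under
the integral sign with the domination constant supplied by compactness, exactly as in the tree's
interval version `Literature.Analysis.FluidPDE.contDiff_intervalIntegral_of_contDiff`). Moreover the
partial iterated derivatives are dominated by the total ones,
`‖iteratedFDeriv ℝ n (f · p) x‖ ≤ ‖iteratedFDeriv ℝ n (uncurry f) (x, p)‖`, so they are bounded on
compact sets uniformly in the parameter (`exists_forall_norm_iteratedFDeriv_apply_le`), which gives the
working estimate `‖iteratedFDeriv ℝ n g x‖ ≤ ∫ p in S, (bound) ∂μ`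
(`norm_iteratedFDeriv_setIntegral_le`).

These are the tools behind the collar estimates of the averaged solenoidal truncation
(divergence-free truncation with collar control, item 2928 of route `RobustBlowupPortability`).

HONEST FRAMING: elementary calculus facts about parametric integrals; nothing here bears on
Navier–Stokes regularity.
-/

noncomputable section

set_option linter.dupNamespace false

namespace Summit.NavierStokesRegularity.NavierStokesRegularity.Theorems

open Set MeasureTheory Filter Topology Function ContinuousLinearMap
open scoped ENNReal NNReal ContDiff

namespace DivFreeTruncation

universe u

variable {H : Type u} [NormedAddCommGroup H] [NormedSpace ℝ H]
variable {P : Type*} [NormedAddCommGroup P] [NormedSpace ℝ P]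

section Partial

/-- The partial derivative in the first variable of a jointly `C¹` map, as a field of continuous
linear maps: `∂ₓ f (x, p) = D(uncurry f)(x, p) ∘ inl`. [folklore] -/
theorem hasFDerivAt_partial_of_contDiff {F : Type*} [NormedAddCommGroup F] [NormedSpace ℝ F]
    {f : H → P → F} (hf : ContDiff ℝ 1 (uncurry f)) (x : H) (p : P) :
    HasFDerivAt (fun y => f y p) ((fderiv ℝ (uncurry f) (x, p)).comp (inl ℝ H P)) x := by
  have h1 : HasFDerivAt (uncurry f) (fderiv ℝ (uncurry f) (x, p)) (x, p) :=
    (hf.differentiable one_ne_zero (x, p)).hasFDerivAt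
  exact h1.comp x (hasFDerivAt_prodMk_left (𝕜 := ℝ) x p)

/-- `fderiv` form of `hasFDerivAt_partial_of_contDiff`. [folklore] -/
theorem fderiv_partial_of_contDiff {F : Type*} [NormedAddCommGroup F] [NormedSpace ℝ F]
    {f : H → P → F} (hf : ContDiff ℝ 1 (uncurry f)) (p : P) :
    fderiv ℝ (fun y => f y p) = fun x => (fderiv ℝ (uncurry f) (x, p)).comp (inl ℝ H P) :=
  funext fun x => (hasFDerivAt_partial_of_contDiff hf x p).fderiv

/-- The field of partial derivatives `(x, p) ↦ ∂ₓ f (x, p)` of a jointly smooth map is jointly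
smooth. [folklore] -/
theorem contDiff_partial_of_contDiff {F : Type*} [NormedAddCommGroup F] [NormedSpace ℝ F]
    {f : H → P → F} (hf : ContDiff ℝ ∞ (uncurry f)) :
    ContDiff ℝ ∞ (uncurry fun x p => (fderiv ℝ (uncurry f) (x, p)).comp (inl ℝ H P)) := by
  have : ContDiff ℝ ∞ fun q : H × P => (fderiv ℝ (uncurry f) q).comp (inl ℝ H P) :=
    (hf.fderiv_right (by exact_mod_cast le_top)).clm_comp contDiff_const
  exact this

/-- The partial iterated derivative is the total one composed with the inclusion `inl`:
`Dⁿ(f · p)(x) = Dⁿ(uncurry f)(x, p) ∘ (inl, …, inl)`. [folklore] -/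
theorem iteratedFDeriv_apply_eq_compContinuousLinearMap {F : Type*} [NormedAddCommGroup F]
    [NormedSpace ℝ F] {f : H → P → F} {N : WithTop ℕ∞} (hf : ContDiff ℝ N (uncurry f)) {n : ℕ}
    (hn : (n : WithTop ℕ∞) ≤ N) (x : H) (p : P) :
    iteratedFDeriv ℝ n (fun y => f y p) x =
      (iteratedFDeriv ℝ n (uncurry f) (x, p)).compContinuousLinearMap fun _ => inl ℝ H P := by
  have h1 : (fun y => f y p) = (fun z : H × P => uncurry f (z + (0, p))) ∘ (inl ℝ H P) := by
    funext y; simp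
  have h2 : ContDiff ℝ N (fun z : H × P => uncurry f (z + (0, p))) :=
    hf.comp (contDiff_id.add contDiff_const)
  rw [h1, ContinuousLinearMap.iteratedFDeriv_comp_right (inl ℝ H P) h2 x hn,
    iteratedFDeriv_comp_add_right n (0, p)]
  simp

/-- **Partial iterated derivatives are dominated by total ones**:
`‖Dⁿ(f · p)(x)‖ ≤ ‖Dⁿ(uncurry f)(x, p)‖` (the inclusion `inl` has norm `≤ 1`). [folklore] -/
theorem norm_iteratedFDeriv_apply_le {F : Type*} [NormedAddCommGroup F] [NormedSpace ℝ F]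
    {f : H → P → F} {N : WithTop ℕ∞} (hf : ContDiff ℝ N (uncurry f)) {n : ℕ}
    (hn : (n : WithTop ℕ∞) ≤ N) (x : H) (p : P) :
    ‖iteratedFDeriv ℝ n (fun y => f y p) x‖ ≤ ‖iteratedFDeriv ℝ n (uncurry f) (x, p)‖ := by
  rw [iteratedFDeriv_apply_eq_compContinuousLinearMap hf hn x p]
  refine (ContinuousMultilinearMap.norm_compContinuousLinearMap_le _ _).trans ?_
  have hprod : ∏ _i : Fin n, ‖inl ℝ H P‖ ≤ 1 :=
    Finset.prod_le_one (fun _ _ => norm_nonneg _) fun _ _ => ContinuousLinearMap.norm_inl_le_one ℝ H P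
  calc ‖iteratedFDeriv ℝ n (uncurry f) (x, p)‖ * ∏ _i : Fin n, ‖inl ℝ H P‖
      ≤ ‖iteratedFDeriv ℝ n (uncurry f) (x, p)‖ * 1 := by gcongr
    _ = _ := mul_one _

/-- **Uniform bounds for partial iterated derivatives on compact sets**: if `(x, p) ↦ f x p` is
smooth and `K ⊆ H`, `S ⊆ P` are compact then `‖Dⁿ(f · p)(x)‖ ≤ M` for all `x ∈ K`, `p ∈ S`
(continuity of `Dⁿ(uncurry f)` on the compact `K × S`). [folklore] -/
theorem exists_forall_norm_iteratedFDeriv_apply_le {F : Type*} [NormedAddCommGroup F]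
    [NormedSpace ℝ F] {f : H → P → F} (hf : ContDiff ℝ ∞ (uncurry f)) {K : Set H}
    (hK : IsCompact K) {S : Set P} (hS : IsCompact S) (n : ℕ) :
    ∃ M : ℝ, 0 ≤ M ∧ ∀ x ∈ K, ∀ p ∈ S, ‖iteratedFDeriv ℝ n (fun y => f y p) x‖ ≤ M := by
  have hc : Continuous fun q : H × P => iteratedFDeriv ℝ n (uncurry f) q :=
    hf.continuous_iteratedFDeriv (by exact_mod_cast le_top)
  obtain ⟨C, hC⟩ := (hK.prod hS).exists_bound_of_continuousOn hc.continuousOn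
  refine ⟨max C 0, le_max_right _ _, fun x hx p hp => ?_⟩
  exact ((norm_iteratedFDeriv_apply_le hf (by exact_mod_cast le_top) x p).trans
    (hC (x, p) ⟨hx, hp⟩)).trans (le_max_left _ _)


end Partial

section Integral

variable [FiniteDimensional ℝ H] [FiniteDimensional ℝ P] [MeasurableSpace P] [BorelSpace P]

/-- **Differentiation under the integral sign over a compact parameter set, `C¹` integrand.**
If `(x, p) ↦ f x p` is `C¹` and `S` is compact then `x ↦ ∫ p in S, f x p ∂μ` has derivative
`∫ p in S, ∂ₓ f x p ∂μ` everywhere (domination by the maximum of `∂ₓ f` on a compact neighbourhood;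
Mathlib's `hasFDerivAt_integral_of_dominated_of_fderiv_le`). [folklore] -/
theorem hasFDerivAt_setIntegral_of_contDiff {F : Type*} [NormedAddCommGroup F] [NormedSpace ℝ F]
    [CompleteSpace F] {f : H → P → F} (hf : ContDiff ℝ 1 (uncurry f)) {S : Set P}
    (hS : IsCompact S) (μ : Measure P) [IsFiniteMeasureOnCompacts μ] (x₀ : H) :
    HasFDerivAt (fun x => ∫ p in S, f x p ∂μ)
      (∫ p in S, (fderiv ℝ (uncurry f) (x₀, p)).comp (inl ℝ H P) ∂μ) x₀ := by
  set f₁ : H → P → H →L[ℝ] F := fun x p => (fderiv ℝ (uncurry f) (x, p)).comp (inl ℝ H P)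
    with hf₁
  have hcont : Continuous (uncurry f) := hf.continuous
  have hcont₁ : Continuous (uncurry f₁) := by
    have : Continuous fun q : H × P => (fderiv ℝ (uncurry f) q).comp (inl ℝ H P) :=
      (hf.continuous_fderiv one_ne_zero).clm_comp continuous_const
    exact this
  obtain ⟨C, hC⟩ := ((isCompact_closedBall x₀ 1).prod hS).exists_bound_of_continuousOn
    (f := uncurry f₁) hcont₁.continuousOn
  refine hasFDerivAt_integral_of_dominated_of_fderiv_le (𝕜 := ℝ) (μ := μ.restrict S)
    (F := f) (F' := f₁) (bound := fun _ => C) (Metric.ball_mem_nhds x₀ one_pos) ?_ ?_ ?_ ?_ ?_ ?_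
  · exact Eventually.of_forall fun x =>
      (hcont.comp (Continuous.prodMk_right x)).aestronglyMeasurable
  · exact (hcont.comp (Continuous.prodMk_right x₀)).continuousOn.integrableOn_compact hS
  · exact (hcont₁.comp (Continuous.prodMk_right x₀)).aestronglyMeasurable
  · refine (ae_restrict_mem hS.measurableSet).mono fun p hp x hx => hC (x, p) ⟨?_, hp⟩
    exact Metric.mem_closedBall.2 (le_of_lt (Metric.mem_ball.1 hx))
  · exact integrableOn_const hS.measure_ne_top
  · exact Eventually.of_forall fun p x _ => hasFDerivAt_partial_of_contDiff hf x p

/-- `fderiv` form of `hasFDerivAt_setIntegral_of_contDiff`. [folklore] -/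
theorem fderiv_setIntegral_of_contDiff {F : Type*} [NormedAddCommGroup F] [NormedSpace ℝ F]
    [CompleteSpace F] {f : H → P → F} (hf : ContDiff ℝ 1 (uncurry f)) {S : Set P}
    (hS : IsCompact S) (μ : Measure P) [IsFiniteMeasureOnCompacts μ] :
    fderiv ℝ (fun x => ∫ p in S, f x p ∂μ) =
      fun x => ∫ p in S, (fderiv ℝ (uncurry f) (x, p)).comp (inl ℝ H P) ∂μ :=
  funext fun x => (hasFDerivAt_setIntegral_of_contDiff hf hS μ x).fderiv

/-- **Smoothness of parametric integrals over a compact parameter set.** If `(x, p) ↦ f x p` is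
`C^∞` (`H`, `P` finite-dimensional) and `S ⊆ P` is compact then `x ↦ ∫ p in S, f x p ∂μ` is `C^∞`
(induction on the order: the derivative is again such an integral). [folklore] -/
theorem contDiff_setIntegral_of_contDiff {F : Type u} [NormedAddCommGroup F] [NormedSpace ℝ F]
    [CompleteSpace F] {f : H → P → F} (hf : ContDiff ℝ ∞ (uncurry f)) {S : Set P}
    (hS : IsCompact S) (μ : Measure P) [IsFiniteMeasureOnCompacts μ] :
    ContDiff ℝ ∞ (fun x => ∫ p in S, f x p ∂μ) := by
  suffices key : ∀ (n : ℕ) {F : Type u} [NormedAddCommGroup F] [NormedSpace ℝ F] [CompleteSpace F]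
      {f : H → P → F}, ContDiff ℝ ∞ (uncurry f) → ContDiff ℝ n (fun x => ∫ p in S, f x p ∂μ) from
    contDiff_infty.2 fun n => key n hf
  intro n
  induction n with
  | zero =>
    intro F _ _ _ f hf
    exact contDiff_zero.2 (continuous_parametric_integral_of_continuous hf.continuous hS)
  | succ n ih =>
    intro F _ _ _ f hf
    have hf1 : ContDiff ℝ 1 (uncurry f) := hf.of_le (by exact_mod_cast le_top)
    rw [show ((n + 1 : ℕ) : WithTop ℕ∞) = (n : WithTop ℕ∞) + 1 by push_cast; rfl,
      contDiff_succ_iff_fderiv]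
    refine ⟨fun x => (hasFDerivAt_setIntegral_of_contDiff hf1 hS μ x).differentiableAt,
      fun h => absurd h (by simp), ?_⟩
    rw [fderiv_setIntegral_of_contDiff hf1 hS μ]
    exact ih (contDiff_partial_of_contDiff hf)

/-- **Iterated derivatives under the integral sign.** For a jointly smooth integrand over a compact
parameter set, `Dⁿ(∫ p in S, f · p ∂μ)(x) = ∫ p in S, Dⁿ(f · p)(x) ∂μ` for every `n`
(induction on `n` through `iteratedFDeriv_succ_eq_comp_right`, the currying isometry commuting with
the Bochner integral). [folklore] -/
theorem iteratedFDeriv_setIntegral_of_contDiff {F : Type u} [NormedAddCommGroup F]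
    [NormedSpace ℝ F] [CompleteSpace F] {f : H → P → F} (hf : ContDiff ℝ ∞ (uncurry f))
    {S : Set P} (hS : IsCompact S) (μ : Measure P) [IsFiniteMeasureOnCompacts μ] (n : ℕ) (x : H) :
    iteratedFDeriv ℝ n (fun y => ∫ p in S, f y p ∂μ) x =
      ∫ p in S, iteratedFDeriv ℝ n (fun y => f y p) x ∂μ := by
  induction n generalizing F with
  | zero =>
    simp only [iteratedFDeriv_zero_eq_comp, comp_apply]
    exact ((continuousMultilinearCurryFin0 ℝ H F).symm.toContinuousLinearEquiv.integral_comp_comm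
      (fun p => f x p)).symm
  | succ n ih =>
    have hf1 : ContDiff ℝ 1 (uncurry f) := hf.of_le (by exact_mod_cast le_top)
    set f₁ : H → P → H →L[ℝ] F := fun x p => (fderiv ℝ (uncurry f) (x, p)).comp (inl ℝ H P)
      with hf₁
    set e := continuousMultilinearCurryRightEquiv' ℝ n H F with he
    have hD : fderiv ℝ (fun y => ∫ p in S, f y p ∂μ) = fun y => ∫ p in S, f₁ y p ∂μ :=
      fderiv_setIntegral_of_contDiff hf1 hS μ
    have hpt : ∀ p, iteratedFDeriv ℝ (n + 1) (fun y => f y p) x =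
        e.symm (iteratedFDeriv ℝ n (fun y => f₁ y p) x) := fun p => by
      rw [iteratedFDeriv_succ_eq_comp_right, comp_apply, fderiv_partial_of_contDiff hf1 p]
    have hcomm := LinearIsometry.integral_comp_comm (𝕜 := ℝ) (μ := μ.restrict S)
      e.symm.toLinearIsometry (fun p => iteratedFDeriv ℝ n (fun y => f₁ y p) x)
    simp only [LinearIsometryEquiv.coe_toLinearIsometry] at hcomm
    calc iteratedFDeriv ℝ (n + 1) (fun y => ∫ p in S, f y p ∂μ) x
        = e.symm (iteratedFDeriv ℝ n (fun y => ∫ p in S, f₁ y p ∂μ) x) := by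
          rw [iteratedFDeriv_succ_eq_comp_right, comp_apply, hD]
      _ = e.symm (∫ p in S, iteratedFDeriv ℝ n (fun y => f₁ y p) x ∂μ) := by
          rw [ih (contDiff_partial_of_contDiff hf)]
      _ = ∫ p in S, e.symm (iteratedFDeriv ℝ n (fun y => f₁ y p) x) ∂μ := hcomm.symm
      _ = ∫ p in S, iteratedFDeriv ℝ (n + 1) (fun y => f y p) x ∂μ := by simp_rw [hpt]

/-- **Working estimate**: with a pointwise bound `‖Dⁿ(f · p)(x)‖ ≤ g p` on `S`, `g` integrable on
`S`, one has `‖Dⁿ(∫ p in S, f · p ∂μ)(x)‖ ≤ ∫ p in S, g p ∂μ`. [folklore] -/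
theorem norm_iteratedFDeriv_setIntegral_le {F : Type u} [NormedAddCommGroup F] [NormedSpace ℝ F]
    [CompleteSpace F] {f : H → P → F} (hf : ContDiff ℝ ∞ (uncurry f)) {S : Set P}
    (hS : IsCompact S) (μ : Measure P) [IsFiniteMeasureOnCompacts μ] (n : ℕ) (x : H)
    {g : P → ℝ} (hg : ∀ p ∈ S, ‖iteratedFDeriv ℝ n (fun y => f y p) x‖ ≤ g p)
    (hgi : IntegrableOn g S μ) :
    ‖iteratedFDeriv ℝ n (fun y => ∫ p in S, f y p ∂μ) x‖ ≤ ∫ p in S, g p ∂μ := by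
  rw [iteratedFDeriv_setIntegral_of_contDiff hf hS μ n x]
  exact norm_integral_le_of_norm_le hgi ((ae_restrict_mem hS.measurableSet).mono hg)


end Integral

end DivFreeTruncation

end Summit.NavierStokesRegularity.NavierStokesRegularity.Theorems
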